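import Mathlib
import HarnessLib

/-!
# Level bookkeeping for the quantile-bit door: tangent-line Jensen on pairs of levels and the split of the antipodal two-time trace by levels

Support module for the door `QuantileBitPurity.QuantileBitDoor` (item stmt-QuantumFields-23925, LINE g12-B of seat ym-idea-4; target leaf
`ThermalTraceWindow.SubFemtoTraceRatio`).  PURE SEQUENCE ALGEBRA, no measure theory: the spectral representation of the two-insertion ring trace
(`eigenData_ringInsTrace`) has the shape `I_t = Σ_{(j,k)} λ_j^{N-t} λ_k^t c_{jk}` with levels `λ_k > 0` (`Σ_k λ_k^N = Z`, the trace formula) and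
non-negative symmetric coefficients `c_{jk} = (∫ O e_j e_k)²` whose rows sum to at most `1` (Bessel, `|O| ≤ 1`).  For such data we prove:

* §1 `pow_mul_pow_le_weighted` — the weighted AM–GM inequality with a free scale `σ > 0`:
  `a^A b^B ≤ (B/N) σ^A b^N + (A/N) σ^{-B} a^N` (`A + B = N ≥ 1`);
* §2 ★ `LevelSplit.pow_le_antipodal_mul_pow` — tangent-line Jensen on pairs of levels (the `SlowBitWindow.JensenDoor` mechanism at general ring length
  and slot; the tangent-line inequality `SlowBitWindow.pow_tangent_le` is re-derived inline so that this module imports no route file): `I_1^m ≤ I_m · Z^{m-1}`;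
* §3 ★ `LevelSplit.antipodal_le_split` — the split of `I_m` by levels (`A = N - m`, `B = m`, both `≥ 1`): for every `σ > 0`,
  `I_m ≤ λ_0^N c_{00} + (Z − λ_0^N)(1 + σ^A + σ^B) + λ_0^N (σ^{-A} + σ^{-B})` — a nearly pure state (`Z − λ_0^N ≪ Z`) factorises across the thermal
  circle up to the ground coefficient `c_{00} = ⟨e_0, O e_0⟩²` (finite partial sums, the `j = 0` row and `k = 0` column separated, AM–GM termwise);
* §4 `LevelSplit.ground_le_antipodal` (`λ_0^N c_{00} ≤ I_m`) and `LevelSplit.double_trace_le` (`Σ λ_k^{2N} ≤ λ_0^N Z` for `λ_k ≤ λ_0`).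

HONEST FRAMING: elementary real analysis for an M-sized support item of a DRAFT line onto a RECORD rung (K2); nothing here bears on infinite volume,
the continuum limit, a mass gap or Clay.  No `sorry`, no new axiom, no new definition.
References: [cite: MadrasSokal1988, §2]; [cite: ReedSimonIV1978, Thm. XIII.1].
-/

set_option autoImplicit false

noncomputable section

open Filter Topology Real Function Finset
open scoped BigOperators

namespace Summit.QuantumFields.YangMills.Theorems.QuantileBitPurity

/-! ## §1 Weighted AM–GM with a free scale -/

/-- **Weighted AM–GM with a free scale.**  For `a, b ≥ 0`, `σ > 0` and naturals `A + B = N ≥ 1`: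
`a^A · b^B ≤ (B/N) · σ^A · b^N + (A/N) · (σ^B)⁻¹ · a^N` (the two-point weighted AM–GM inequality for `σ^A b^N` and `σ^{-B} a^N` with weights
`B/N`, `A/N`). [folklore] -/
theorem pow_mul_pow_le_weighted {a b σ : ℝ} (ha : 0 ≤ a) (hb : 0 ≤ b) (hσ : 0 < σ) {A B N : ℕ} (hN : 1 ≤ N) (hAB : A + B = N) :
    a ^ A * b ^ B ≤ (B : ℝ) / N * (σ ^ A * b ^ N) + (A : ℝ) / N * ((σ ^ B)⁻¹ * a ^ N) := by
  have hN0 : (N : ℝ) ≠ 0 := by exact_mod_cast (show N ≠ 0 by omega)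
  have hNpos : (0 : ℝ) < N := by exact_mod_cast (show 0 < N by omega)
  have hw1 : 0 ≤ (B : ℝ) / N := by positivity
  have hw2 : 0 ≤ (A : ℝ) / N := by positivity
  have hw : (B : ℝ) / N + (A : ℝ) / N = 1 := by
    rw [← add_div, div_eq_one_iff_eq hN0]; exact_mod_cast (by omega : B + A = N)
  have hp1 : 0 ≤ σ ^ A * b ^ N := by positivity
  have hp2 : 0 ≤ (σ ^ B)⁻¹ * a ^ N := by positivity
  have h := Real.geom_mean_le_arith_mean2_weighted hw1 hw2 hp1 hp2 hw
  -- identify the geometric mean with `a^A b^B`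
  have hσA : 0 ≤ σ ^ A := by positivity
  have hσB : 0 < σ ^ B := by positivity
  have e1 : (σ ^ A * b ^ N) ^ ((B : ℝ) / N) = σ ^ ((A : ℝ) * B / N) * b ^ B := by
    rw [Real.mul_rpow hσA (by positivity), ← Real.rpow_natCast σ A, ← Real.rpow_mul hσ.le, ← Real.rpow_natCast b N,
      ← Real.rpow_mul hb, ← Real.rpow_natCast b B]
    congr 1
    · congr 1; ring
    · congr 1; field_simp
  have e2 : ((σ ^ B)⁻¹ * a ^ N) ^ ((A : ℝ) / N) = σ ^ (-((A : ℝ) * B / N)) * a ^ A := by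
    rw [Real.mul_rpow (by positivity) (by positivity), Real.inv_rpow hσB.le, ← Real.rpow_natCast σ B, ← Real.rpow_mul hσ.le,
      ← Real.rpow_neg hσ.le, ← Real.rpow_natCast a N, ← Real.rpow_mul ha, ← Real.rpow_natCast a A]
    congr 1
    · congr 1; ring
    · congr 1; field_simp
  have e3 : (σ ^ A * b ^ N) ^ ((B : ℝ) / N) * ((σ ^ B)⁻¹ * a ^ N) ^ ((A : ℝ) / N) = a ^ A * b ^ B := by
    rw [e1, e2, Real.rpow_neg hσ.le]
    have hne : σ ^ ((A : ℝ) * B / N) ≠ 0 := (Real.rpow_pos_of_pos hσ _).ne'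
    field_simp
  rw [e3] at h
  exact h

/-! ## §2 Tangent-line Jensen on pairs of levels -/

namespace LevelSplit

variable {lam : ℕ → ℝ} {c : ℕ → ℕ → ℝ} {N : ℕ} {Z : ℝ}

/-- The weights `w_{jk} = λ_j^N c_{jk}` are summable on `ℕ × ℕ` with `Σ w ≤ Z` (row sums `Σ_k c_{jk} ≤ 1`, trace formula `Σ_j λ_j^N = Z`). [folklore] -/
theorem summable_weights_le (hlam : ∀ k, 0 < lam k) (hc0 : ∀ j k, 0 ≤ c j k) (hrow : ∀ j, Summable (c j) ∧ ∑' k, c j k ≤ 1)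
    (hZ : HasSum (fun k => lam k ^ N) Z) :
    Summable (fun p : ℕ × ℕ => lam p.1 ^ N * c p.1 p.2) ∧ ∑' p : ℕ × ℕ, lam p.1 ^ N * c p.1 p.2 ≤ Z := by
  set w : ℕ × ℕ → ℝ := fun p => lam p.1 ^ N * c p.1 p.2 with hwdef
  have hw0 : ∀ p, 0 ≤ w p := fun p => mul_nonneg (pow_nonneg (hlam _).le _) (hc0 _ _)
  have hrowS : ∀ j, HasSum (fun k => w (j, k)) (lam j ^ N * ∑' k, c j k) := fun j =>
    ((hrow j).1.hasSum).mul_left (lam j ^ N)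
  have hg0 : ∀ j, 0 ≤ lam j ^ N * ∑' k, c j k := fun j => mul_nonneg (pow_nonneg (hlam j).le _) (tsum_nonneg (hc0 j))
  have hgle : ∀ j, lam j ^ N * ∑' k, c j k ≤ lam j ^ N := fun j => by
    have h := mul_le_mul_of_nonneg_left (hrow j).2 (pow_nonneg (hlam j).le N)
    rwa [mul_one] at h
  have hgs : Summable fun j => lam j ^ N * ∑' k, c j k := Summable.of_nonneg_of_le hg0 hgle hZ.summable
  have hWs : Summable w := by
    refine (summable_prod_of_nonneg hw0).mpr ⟨fun j => (hrowS j).summable, ?_⟩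
    exact hgs.congr fun j => ((hrowS j).tsum_eq).symm
  refine ⟨hWs, ?_⟩
  rw [← (hWs.hasSum.prod_fiberwise hrowS).tsum_eq, ← hZ.tsum_eq]
  exact hgs.tsum_le_tsum hgle hZ.summable

/-- ★ **Tangent-line Jensen on pairs of levels**: with `I_t = Σ_{(j,k)} λ_j^{N-t} λ_k^t c_{jk}` (`λ > 0`, `c ≥ 0`, rows of `c` summing to `≤ 1`,
`Σ λ_j^N = Z`) and `1 ≤ m ≤ N`: `I_1^m ≤ I_m · Z^{m-1}` — convexity of `x ↦ x^m` along the weights `w_{jk} = λ_j^N c_{jk}` at the ratios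
`x_{jk} = λ_k/λ_j`, tangent line at `s = I_1 / Σ w`, and `Σ w ≤ Z`. [cite: MadrasSokal1988, §2] [cite: ReedSimonIV1978, Thm. XIII.1] -/
theorem pow_le_antipodal_mul_pow (hlam : ∀ k, 0 < lam k) (hc0 : ∀ j k, 0 ≤ c j k) (hrow : ∀ j, Summable (c j) ∧ ∑' k, c j k ≤ 1)
    (hZ : HasSum (fun k => lam k ^ N) Z) {m : ℕ} (hm : 1 ≤ m) (hmN : m ≤ N) {I1 Im : ℝ}
    (hI1 : HasSum (fun p : ℕ × ℕ => lam p.1 ^ (N - 1) * lam p.2 ^ 1 * c p.1 p.2) I1)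
    (hIm : HasSum (fun p : ℕ × ℕ => lam p.1 ^ (N - m) * lam p.2 ^ m * c p.1 p.2) Im) :
    I1 ^ m ≤ Im * Z ^ (m - 1) := by
  have h1N : 1 ≤ N := hm.trans hmN
  -- the tangent line of `x ↦ x^m` at `s ≥ 0` (convexity on `[0, ∞)`; cf. `SlowBitWindow.pow_tangent_le`)
  have htan : ∀ {x s : ℝ}, 0 ≤ x → 0 ≤ s → s ^ m + m * s ^ (m - 1) * (x - s) ≤ x ^ m := by
    intro x s hx hs
    rcases hs.eq_or_lt with hs0 | hs0
    · subst hs0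
      rcases Nat.eq_or_lt_of_le hm with hm1 | hm1
      · subst hm1; simp
      · rw [zero_pow (by omega), zero_pow (by omega)]; simpa using pow_nonneg hx m
    · set t : ℝ := x / s - 1 with ht
      have hxt : x = s * (1 + t) := by rw [ht]; field_simp; ring
      have ht2 : -2 ≤ t := by
        have : 0 ≤ x / s := div_nonneg hx hs0.le
        rw [ht]; linarith
      have hB := one_add_mul_le_pow ht2 m
      have hsm : s ^ m = s * s ^ (m - 1) := by
        rw [← pow_succ']; congr 1; omega
      calc s ^ m + m * s ^ (m - 1) * (x - s) = s ^ m * (1 + m * t) := by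
            rw [hxt, hsm]; ring
        _ ≤ s ^ m * (1 + t) ^ m := mul_le_mul_of_nonneg_left hB (pow_nonneg hs0.le m)
        _ = x ^ m := by rw [hxt, mul_pow]
  set w : ℕ × ℕ → ℝ := fun p => lam p.1 ^ N * c p.1 p.2 with hwdef
  set r : ℕ × ℕ → ℝ := fun p => lam p.2 / lam p.1 with hrdef
  set F1 : ℕ × ℕ → ℝ := fun p => lam p.1 ^ (N - 1) * lam p.2 ^ 1 * c p.1 p.2 with hF1def
  set Fm : ℕ × ℕ → ℝ := fun p => lam p.1 ^ (N - m) * lam p.2 ^ m * c p.1 p.2 with hFmdef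
  have hw0 : ∀ p, 0 ≤ w p := fun p => mul_nonneg (pow_nonneg (hlam _).le _) (hc0 _ _)
  have hr0 : ∀ p, 0 ≤ r p := fun p => div_nonneg (hlam _).le (hlam _).le
  have hF1w : ∀ p, F1 p = w p * r p := fun p => by
    simp only [hF1def, hwdef, hrdef]
    have hk : lam p.1 ≠ 0 := (hlam p.1).ne'
    have e1 : lam p.1 ^ N = lam p.1 ^ (N - 1) * lam p.1 := by
      rw [← pow_succ]; congr 1; omega
    rw [e1]; field_simp
  have hFmw : ∀ p, Fm p = w p * r p ^ m := fun p => by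
    simp only [hFmdef, hwdef, hrdef]
    have hk : lam p.1 ≠ 0 := (hlam p.1).ne'
    have e1 : lam p.1 ^ N = lam p.1 ^ (N - m) * lam p.1 ^ m := by
      rw [← pow_add]; congr 1; omega
    rw [e1, div_pow]; field_simp
  obtain ⟨hWs, hWle⟩ := summable_weights_le hlam hc0 hrow hZ
  set SW : ℝ := ∑' p : ℕ × ℕ, w p with hSWdef
  have hW : HasSum w SW := hWs.hasSum
  have hSW0 : 0 ≤ SW := tsum_nonneg hw0
  have hZ0 : 0 ≤ Z := hSW0.trans hWle
  have hI1_0 : 0 ≤ I1 := hI1.nonneg (fun p => by rw [hF1w p]; exact mul_nonneg (hw0 p) (hr0 p))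
  have hIm_0 : 0 ≤ Im := hIm.nonneg (fun p => by rw [hFmw p]; exact mul_nonneg (hw0 p) (pow_nonneg (hr0 p) m))
  -- the power-mean inequality `(Σ w r)^m ≤ (Σ w)^(m-1) Σ w r^m`
  have hkey : I1 ^ m ≤ Im * SW ^ (m - 1) := by
    rcases hSW0.eq_or_lt with hSW | hSW
    · -- all weights vanish
      have hw00 : ∀ p, w p = 0 := fun p => by
        have h := (hasSum_zero_iff_of_nonneg hw0).mp (hSW ▸ hW)
        exact congrFun h p
      have hI1z : I1 = 0 := by
        have h : F1 = fun _ => 0 := funext fun p => by rw [hF1w, hw00, zero_mul]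
        have h1 : HasSum F1 I1 := hI1
        rw [h] at h1
        exact h1.unique hasSum_zero ▸ rfl
      rw [hI1z, zero_pow (by omega)]
      exact mul_nonneg hIm_0 (pow_nonneg hSW0 _)
    · set s : ℝ := I1 / SW with hsdef
      have hs0 : 0 ≤ s := div_nonneg hI1_0 hSW.le
      -- sum the tangent inequality `w (s^m + m s^(m-1) (r - s)) ≤ w r^m`
      have hdom : ∀ p, w p * s ^ m + (m : ℝ) * s ^ (m - 1) * (w p * r p - s * w p) ≤ Fm p := fun p => by
        rw [hFmw]
        have h := mul_le_mul_of_nonneg_left (htan (hr0 p) hs0) (hw0 p)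
        nlinarith [h]
      have hS1' : HasSum (fun p => w p * r p) I1 := hI1.congr_fun fun p => (hF1w p).symm
      have hG : HasSum (fun p => w p * s ^ m + (m : ℝ) * s ^ (m - 1) * (w p * r p - s * w p))
          (SW * s ^ m + (m : ℝ) * s ^ (m - 1) * (I1 - s * SW)) :=
        (hW.mul_right (s ^ m)).add ((hS1'.sub (hW.mul_left s)).mul_left _)
      have hle := hasSum_le hdom hG hIm
      have hcancel : I1 - s * SW = 0 := by rw [hsdef]; field_simp; ring
      rw [hcancel, mul_zero, add_zero] at hle
      have hSWpow : SW * s ^ m * SW ^ (m - 1) = I1 ^ m := by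
        rw [hsdef, div_pow]
        have hSWm : SW ^ m = SW * SW ^ (m - 1) := by rw [← pow_succ']; congr 1; omega
        rw [hSWm]; field_simp
      calc I1 ^ m = SW * s ^ m * SW ^ (m - 1) := hSWpow.symm
        _ ≤ Im * SW ^ (m - 1) := mul_le_mul_of_nonneg_right hle (pow_nonneg hSW0 _)
  calc I1 ^ m ≤ Im * SW ^ (m - 1) := hkey
    _ ≤ Im * Z ^ (m - 1) := mul_le_mul_of_nonneg_left (pow_le_pow_left₀ hSW0 hWle _) hIm_0

/-! ## §3 The split of the antipodal trace by levels -/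

/-- A finite partial sum of `λ_k^N` over indices `k ≠ 0` is at most the excited trace `Z − λ_0^N`. [folklore] -/
theorem sum_pow_le_excited (hlam : ∀ k, 0 < lam k) (hZ : HasSum (fun k => lam k ^ N) Z) {T : Finset ℕ} (hT : 0 ∉ T) :
    ∑ k ∈ T, lam k ^ N ≤ Z - lam 0 ^ N := by
  have h := sum_le_hasSum (insert 0 T) (fun k _ => pow_nonneg (hlam k).le N) hZ
  rw [Finset.sum_insert hT] at h
  linarith

/-- A finite partial row sum of `c` is at most `1`. [folklore] -/
theorem sum_row_le_one (hc0 : ∀ j k, 0 ≤ c j k) (hrow : ∀ j, Summable (c j) ∧ ∑' k, c j k ≤ 1) (j : ℕ) (T : Finset ℕ) :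
    ∑ k ∈ T, c j k ≤ 1 :=
  ((hrow j).1.sum_le_tsum T fun k _ => hc0 j k).trans (hrow j).2

/-- ★ **The split of the antipodal two-time trace by levels.**  With `I = Σ_{(j,k)} λ_j^A λ_k^B c_{jk}` (`λ > 0`, `c ≥ 0` symmetric with rows
summing to `≤ 1`, `Σ λ_j^N = Z`, `A, B ≥ 1`, `A + B = N`) and any scale `σ > 0`:
`I ≤ λ_0^N c_{00} + (Z − λ_0^N)(1 + σ^A + σ^B) + λ_0^N ((σ^A)⁻¹ + (σ^B)⁻¹)`.
The `j = 0` row and `k = 0` column (cross terms) are bounded by the scaled AM–GM inequality, the bulk `j, k ≥ 1` by the weighted AM–GM inequality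
and the row/column sums; everything on finite partial sums. [cite: ReedSimonIV1978, Thm. XIII.1] -/
theorem antipodal_le_split (hlam : ∀ k, 0 < lam k) (hc0 : ∀ j k, 0 ≤ c j k) (hrow : ∀ j, Summable (c j) ∧ ∑' k, c j k ≤ 1)
    (hsymm : ∀ j k, c j k = c k j) (hZ : HasSum (fun k => lam k ^ N) Z) {A B : ℕ} (hA : 1 ≤ A) (hB : 1 ≤ B) (hAB : A + B = N) {I : ℝ}
    (hI : HasSum (fun p : ℕ × ℕ => lam p.1 ^ A * lam p.2 ^ B * c p.1 p.2) I) {σ : ℝ} (hσ : 0 < σ) :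
    I ≤ lam 0 ^ N * c 0 0 + (Z - lam 0 ^ N) * (1 + σ ^ A + σ ^ B) + lam 0 ^ N * ((σ ^ A)⁻¹ + (σ ^ B)⁻¹) := by
  have hN : 1 ≤ N := by omega
  set F : ℕ × ℕ → ℝ := fun p => lam p.1 ^ A * lam p.2 ^ B * c p.1 p.2 with hFdef
  have hF0 : ∀ p, 0 ≤ F p := fun p => mul_nonneg (mul_nonneg (pow_nonneg (hlam _).le _) (pow_nonneg (hlam _).le _)) (hc0 _ _)
  set E : ℝ := Z - lam 0 ^ N with hEdef
  have hE0 : 0 ≤ E := by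
    have h := sum_pow_le_excited hlam hZ (T := ∅) (Finset.notMem_empty 0)
    rw [Finset.sum_empty] at h
    rw [hEdef]; exact h
  have hl0 : 0 ≤ lam 0 ^ N := pow_nonneg (hlam 0).le N
  have hcol : ∀ (k : ℕ) (T : Finset ℕ), ∑ j ∈ T, c j k ≤ 1 := fun k T => by
    have h := sum_row_le_one hc0 hrow k T
    calc ∑ j ∈ T, c j k = ∑ j ∈ T, c k j := Finset.sum_congr rfl fun j _ => hsymm j k
      _ ≤ 1 := h
  have hc1 : ∀ j k, c j k ≤ 1 := fun j k => by
    have h := sum_row_le_one hc0 hrow j {k}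
    rwa [Finset.sum_singleton] at h
  refine hasSum_le_of_sum_le hI fun s => ?_
  -- enlarge `s` to a product of finsets containing `0`
  set T₁ : Finset ℕ := insert 0 (s.image Prod.fst) with hT₁
  set T₂ : Finset ℕ := insert 0 (s.image Prod.snd) with hT₂
  have hsub : s ⊆ T₁ ×ˢ T₂ := fun p hp =>
    Finset.mem_product.mpr ⟨Finset.mem_insert_of_mem (Finset.mem_image_of_mem _ hp), Finset.mem_insert_of_mem (Finset.mem_image_of_mem _ hp)⟩
  have h1 : ∑ p ∈ s, F p ≤ ∑ p ∈ T₁ ×ˢ T₂, F p := Finset.sum_le_sum_of_subset_of_nonneg hsub fun p _ _ => hF0 p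
  refine h1.trans ?_
  rw [Finset.sum_product]
  -- separate `j = 0` and `k = 0`
  set T₁' : Finset ℕ := T₁.erase 0 with hT₁'
  set T₂' : Finset ℕ := T₂.erase 0 with hT₂'
  have hT₁e : T₁ = insert 0 T₁' := (Finset.insert_erase (Finset.mem_insert_self 0 _)).symm
  have hT₂e : T₂ = insert 0 T₂' := (Finset.insert_erase (Finset.mem_insert_self 0 _)).symm
  have h01 : (0 : ℕ) ∉ T₁' := Finset.notMem_erase 0 T₁
  have h02 : (0 : ℕ) ∉ T₂' := Finset.notMem_erase 0 T₂
  have hrowsplit : ∀ j, ∑ k ∈ T₂, F (j, k) = F (j, 0) + ∑ k ∈ T₂', F (j, k) := fun j => by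
    rw [hT₂e, Finset.sum_insert h02]
  simp only [hrowsplit]
  rw [Finset.sum_add_distrib, hT₁e, Finset.sum_insert h01, Finset.sum_insert h01]
  -- (a) the ground term
  have ha : F (0, 0) = lam 0 ^ N * c 0 0 := by
    simp only [hFdef]; rw [← pow_add, hAB]
  -- (b) the column `k = 0`, `j ≥ 1`: `λ_j^A λ_0^B ≤ (B/N) σ^A ... ` — use AM–GM with the roles `(a, b) = (λ_0, λ_j)` swapped appropriately
  have hb : ∑ j ∈ T₁', F (j, 0) ≤ σ ^ B * E + (σ ^ A)⁻¹ * lam 0 ^ N := by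
    have hterm : ∀ j ∈ T₁', F (j, 0) ≤ σ ^ B * (lam j ^ N * c j 0) + (σ ^ A)⁻¹ * lam 0 ^ N * c j 0 := by
      intro j _
      simp only [hFdef]
      -- `λ_j^A λ_0^B = λ_0^B λ_j^A ≤ (A/N) σ^B λ_j^N + (B/N) σ^{-A} λ_0^N`
      have h := pow_mul_pow_le_weighted (hlam 0).le (hlam j).le hσ hN (by omega : B + A = N)
      have hAN : (A : ℝ) / N ≤ 1 := by
        rw [div_le_one (by exact_mod_cast (show 0 < N by omega))]; exact_mod_cast (show A ≤ N by omega)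
      have hBN : (B : ℝ) / N ≤ 1 := by
        rw [div_le_one (by exact_mod_cast (show 0 < N by omega))]; exact_mod_cast (show B ≤ N by omega)
      have hx : 0 ≤ σ ^ B * lam j ^ N := mul_nonneg (pow_nonneg hσ.le _) (pow_nonneg (hlam j).le N)
      have hy : 0 ≤ (σ ^ A)⁻¹ * lam 0 ^ N := mul_nonneg (inv_nonneg.mpr (pow_nonneg hσ.le _)) hl0
      have h2 : lam 0 ^ B * lam j ^ A ≤ σ ^ B * lam j ^ N + (σ ^ A)⁻¹ * lam 0 ^ N := by
        calc lam 0 ^ B * lam j ^ A ≤ (A : ℝ) / N * (σ ^ B * lam j ^ N) + (B : ℝ) / N * ((σ ^ A)⁻¹ * lam 0 ^ N) := h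
          _ ≤ 1 * (σ ^ B * lam j ^ N) + 1 * ((σ ^ A)⁻¹ * lam 0 ^ N) :=
              add_le_add (mul_le_mul_of_nonneg_right hAN hx) (mul_le_mul_of_nonneg_right hBN hy)
          _ = σ ^ B * lam j ^ N + (σ ^ A)⁻¹ * lam 0 ^ N := by ring
      have h3 := mul_le_mul_of_nonneg_right h2 (hc0 j 0)
      calc lam j ^ A * lam 0 ^ B * c j 0 = lam 0 ^ B * lam j ^ A * c j 0 := by ring
        _ ≤ (σ ^ B * lam j ^ N + (σ ^ A)⁻¹ * lam 0 ^ N) * c j 0 := h3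
        _ = σ ^ B * (lam j ^ N * c j 0) + (σ ^ A)⁻¹ * lam 0 ^ N * c j 0 := by ring
    refine (Finset.sum_le_sum hterm).trans ?_
    rw [Finset.sum_add_distrib, ← Finset.mul_sum, ← Finset.mul_sum]
    have hs1 : ∑ j ∈ T₁', lam j ^ N * c j 0 ≤ E := by
      calc ∑ j ∈ T₁', lam j ^ N * c j 0 ≤ ∑ j ∈ T₁', lam j ^ N :=
            Finset.sum_le_sum fun j _ => by
              have := mul_le_mul_of_nonneg_left (hc1 j 0) (pow_nonneg (hlam j).le N); rwa [mul_one] at this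
        _ ≤ E := sum_pow_le_excited hlam hZ h01
    have hs2 : ∑ j ∈ T₁', c j 0 ≤ 1 := hcol 0 T₁'
    have hσB : 0 ≤ σ ^ B := by positivity
    have hσA : 0 ≤ (σ ^ A)⁻¹ * lam 0 ^ N := mul_nonneg (inv_nonneg.mpr (pow_nonneg hσ.le _)) hl0
    calc σ ^ B * ∑ j ∈ T₁', lam j ^ N * c j 0 + (σ ^ A)⁻¹ * lam 0 ^ N * ∑ j ∈ T₁', c j 0
        ≤ σ ^ B * E + (σ ^ A)⁻¹ * lam 0 ^ N * 1 := add_le_add (mul_le_mul_of_nonneg_left hs1 hσB) (mul_le_mul_of_nonneg_left hs2 hσA)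
      _ = σ ^ B * E + (σ ^ A)⁻¹ * lam 0 ^ N := by ring
  -- (c) the row `j = 0`, `k ≥ 1`
  have hc : ∑ k ∈ T₂', F (0, k) ≤ σ ^ A * E + (σ ^ B)⁻¹ * lam 0 ^ N := by
    have hterm : ∀ k ∈ T₂', F (0, k) ≤ σ ^ A * (lam k ^ N * c 0 k) + (σ ^ B)⁻¹ * lam 0 ^ N * c 0 k := by
      intro k _
      simp only [hFdef]
      have h := pow_mul_pow_le_weighted (hlam 0).le (hlam k).le hσ hN hAB
      have hAN : (A : ℝ) / N ≤ 1 := by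
        rw [div_le_one (by exact_mod_cast (show 0 < N by omega))]; exact_mod_cast (show A ≤ N by omega)
      have hBN : (B : ℝ) / N ≤ 1 := by
        rw [div_le_one (by exact_mod_cast (show 0 < N by omega))]; exact_mod_cast (show B ≤ N by omega)
      have hx : 0 ≤ σ ^ A * lam k ^ N := mul_nonneg (pow_nonneg hσ.le _) (pow_nonneg (hlam k).le N)
      have hy : 0 ≤ (σ ^ B)⁻¹ * lam 0 ^ N := mul_nonneg (inv_nonneg.mpr (pow_nonneg hσ.le _)) hl0
      have h2 : lam 0 ^ A * lam k ^ B ≤ σ ^ A * lam k ^ N + (σ ^ B)⁻¹ * lam 0 ^ N := by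
        calc lam 0 ^ A * lam k ^ B ≤ (B : ℝ) / N * (σ ^ A * lam k ^ N) + (A : ℝ) / N * ((σ ^ B)⁻¹ * lam 0 ^ N) := h
          _ ≤ 1 * (σ ^ A * lam k ^ N) + 1 * ((σ ^ B)⁻¹ * lam 0 ^ N) :=
              add_le_add (mul_le_mul_of_nonneg_right hBN hx) (mul_le_mul_of_nonneg_right hAN hy)
          _ = σ ^ A * lam k ^ N + (σ ^ B)⁻¹ * lam 0 ^ N := by ring
      have h3 := mul_le_mul_of_nonneg_right h2 (hc0 0 k)
      calc lam 0 ^ A * lam k ^ B * c 0 k ≤ (σ ^ A * lam k ^ N + (σ ^ B)⁻¹ * lam 0 ^ N) * c 0 k := h3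
        _ = σ ^ A * (lam k ^ N * c 0 k) + (σ ^ B)⁻¹ * lam 0 ^ N * c 0 k := by ring
    refine (Finset.sum_le_sum hterm).trans ?_
    rw [Finset.sum_add_distrib, ← Finset.mul_sum, ← Finset.mul_sum]
    have hs1 : ∑ k ∈ T₂', lam k ^ N * c 0 k ≤ E := by
      calc ∑ k ∈ T₂', lam k ^ N * c 0 k ≤ ∑ k ∈ T₂', lam k ^ N :=
            Finset.sum_le_sum fun k _ => by
              have := mul_le_mul_of_nonneg_left (hc1 0 k) (pow_nonneg (hlam k).le N); rwa [mul_one] at this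
        _ ≤ E := sum_pow_le_excited hlam hZ h02
    have hs2 : ∑ k ∈ T₂', c 0 k ≤ 1 := sum_row_le_one hc0 hrow 0 T₂'
    have hσA : 0 ≤ σ ^ A := by positivity
    have hσB : 0 ≤ (σ ^ B)⁻¹ * lam 0 ^ N := mul_nonneg (inv_nonneg.mpr (pow_nonneg hσ.le _)) hl0
    calc σ ^ A * ∑ k ∈ T₂', lam k ^ N * c 0 k + (σ ^ B)⁻¹ * lam 0 ^ N * ∑ k ∈ T₂', c 0 k
        ≤ σ ^ A * E + (σ ^ B)⁻¹ * lam 0 ^ N * 1 := add_le_add (mul_le_mul_of_nonneg_left hs1 hσA) (mul_le_mul_of_nonneg_left hs2 hσB)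
      _ = σ ^ A * E + (σ ^ B)⁻¹ * lam 0 ^ N := by ring
  -- (d) the bulk `j, k ≥ 1`
  have hd : ∑ j ∈ T₁', ∑ k ∈ T₂', F (j, k) ≤ E := by
    have hterm : ∀ j k, F (j, k) ≤ (A : ℝ) / N * (lam j ^ N * c j k) + (B : ℝ) / N * (lam k ^ N * c j k) := by
      intro j k
      simp only [hFdef]
      have h := pow_mul_pow_le_weighted (hlam j).le (hlam k).le zero_lt_one hN hAB
      rw [one_pow, one_pow, inv_one, one_mul, one_mul] at h
      have h3 := mul_le_mul_of_nonneg_right h (hc0 j k)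
      calc lam j ^ A * lam k ^ B * c j k ≤ ((B : ℝ) / N * lam k ^ N + (A : ℝ) / N * lam j ^ N) * c j k := h3
        _ = (A : ℝ) / N * (lam j ^ N * c j k) + (B : ℝ) / N * (lam k ^ N * c j k) := by ring
    have hNpos : (0 : ℝ) < N := by exact_mod_cast (show 0 < N by omega)
    have hw1 : 0 ≤ (A : ℝ) / N := by positivity
    have hw2 : 0 ≤ (B : ℝ) / N := by positivity
    calc ∑ j ∈ T₁', ∑ k ∈ T₂', F (j, k)
        ≤ ∑ j ∈ T₁', ∑ k ∈ T₂', ((A : ℝ) / N * (lam j ^ N * c j k) + (B : ℝ) / N * (lam k ^ N * c j k)) :=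
          Finset.sum_le_sum fun j _ => Finset.sum_le_sum fun k _ => hterm j k
      _ = (A : ℝ) / N * ∑ j ∈ T₁', lam j ^ N * ∑ k ∈ T₂', c j k + (B : ℝ) / N * ∑ k ∈ T₂', lam k ^ N * ∑ j ∈ T₁', c j k := by
          simp only [Finset.sum_add_distrib, Finset.mul_sum]
          congr 1
          rw [Finset.sum_comm]
      _ ≤ (A : ℝ) / N * ∑ j ∈ T₁', lam j ^ N + (B : ℝ) / N * ∑ k ∈ T₂', lam k ^ N := by
          refine add_le_add (mul_le_mul_of_nonneg_left (Finset.sum_le_sum fun j _ => ?_) hw1)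
            (mul_le_mul_of_nonneg_left (Finset.sum_le_sum fun k _ => ?_) hw2)
          · have := mul_le_mul_of_nonneg_left (sum_row_le_one hc0 hrow j T₂') (pow_nonneg (hlam j).le N); rwa [mul_one] at this
          · have := mul_le_mul_of_nonneg_left (hcol k T₁') (pow_nonneg (hlam k).le N); rwa [mul_one] at this
      _ ≤ (A : ℝ) / N * E + (B : ℝ) / N * E :=
          add_le_add (mul_le_mul_of_nonneg_left (sum_pow_le_excited hlam hZ h01) hw1)
            (mul_le_mul_of_nonneg_left (sum_pow_le_excited hlam hZ h02) hw2)
      _ = E := by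
          rw [← add_mul, ← add_div, div_eq_one_iff_eq (hNpos.ne') |>.mpr (by exact_mod_cast hAB), one_mul]
  -- assemble
  have hσA0 : 0 ≤ σ ^ A := by positivity
  have hσB0 : 0 ≤ σ ^ B := by positivity
  rw [ha]
  nlinarith [hb, hc, hd, hE0, hl0, hσA0, hσB0, inv_nonneg.mpr hσA0, inv_nonneg.mpr hσB0]

/-! ## §4 The ground term and the double trace -/

/-- **Ground term**: every term of the double sum is non-negative, so `λ_0^N c_{00} = λ_0^A λ_0^B c_{00} ≤ I`. [folklore] -/
theorem ground_le_antipodal (hlam : ∀ k, 0 < lam k) (hc0 : ∀ j k, 0 ≤ c j k) {A B : ℕ} (hAB : A + B = N) {I : ℝ}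
    (hI : HasSum (fun p : ℕ × ℕ => lam p.1 ^ A * lam p.2 ^ B * c p.1 p.2) I) :
    lam 0 ^ N * c 0 0 ≤ I := by
  have h := le_hasSum hI (0, 0) fun p _ => mul_nonneg (mul_nonneg (pow_nonneg (hlam _).le _) (pow_nonneg (hlam _).le _)) (hc0 _ _)
  simpa only [← pow_add, hAB] using h

/-- **Double trace**: `Σ λ_k^{2N} ≤ λ_0^N · Σ λ_k^N` when `0 < λ_k ≤ λ_0` (so `Z_phys(2L) ≤ λ_0^L Z_phys(L)` by the trace formula). [folklore] -/
theorem double_trace_le (hlam : ∀ k, 0 < lam k) (hle : ∀ k, lam k ≤ lam 0) (hZ : HasSum (fun k => lam k ^ N) Z) {Z2 : ℝ}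
    (hZ2 : HasSum (fun k => lam k ^ (2 * N)) Z2) : Z2 ≤ lam 0 ^ N * Z := by
  refine hasSum_le (fun k => ?_) hZ2 (hZ.mul_left (lam 0 ^ N))
  rw [two_mul, pow_add]
  exact mul_le_mul_of_nonneg_right (pow_le_pow_left₀ (hlam k).le (hle k) N) (pow_nonneg (hlam k).le N)

end LevelSplit

end Summit.QuantumFields.YangMills.Theorems.QuantileBitPurity

end
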